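import Summits.Ventures.Crystal3D.Theorems.StickyWulffConstantCoaxialWallLawJammedReduction
import HarnessLib

/-!
# U-A1 WINDOWS ARE MONO-MODULE: `JammedOneAt X z → ¬ OnSiteAt 𝒰_cx X z → MonoModuleAt L X z`, hence `JammedOneSmall s k₀` outright
# (crux `CoaxialWallLaw`, stmt-Ventures-19481; line `WallLedgerF`, skeleton 'CoaxialWallLawCertificates' v5, stub `stub_jammedOneSmall`)

HONEST FRAMING. Venture `Summits/Ventures/Crystal3D` (cell `crystal3d-full`), helper `--supports` the crux `CoaxialWallLaw` of
`route-Ventures-StickyWulffConstant` (REGISTERED line `WallLedgerF`, skeleton 'Certificates' v5, cf-p1 12:58Z).  Rung credit only; F-C1 not moved; census-free.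
SHARPER THAN `…JammedReduction` (which reduced the U-A1 stub to the finite census `JammedOneCensus`): the U-A1 regime is EMPTY inside `MultiGrainSmallHigh` —
a payer window that is a coaxial-module pattern plus ONE jammed ball `x` of `≤ 3` contacts is always MONO-MODULE (so it belongs to `ModuleCapture`/`MonoCapture`/
`LensCert`, whose lens types carry loose fillers), because every position the automaton can inspect near such a window is an EXACT position:
* `mem_exactPos_of_mirror` — a mirrored-dozen position `q + (G w − 2⟪G w, m⟫ m)` of a module ball `q` (slot images of `G` on the module, `m` a menu normal of
  `G`), if off the module and within `3` of the payer, is a first-generation apex position (`exists_inplane_slot_triangle` + `mem_exactPos_of_capping`): it caps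
  the module triangle `{q, q + G u₁, q + G u₂}` of the two in-plane slots adjacent to `w`;
* **`monoModuleAt_of_jammedOneAt`** — `1`-separated `X`, payer `z` of degree `≤ 11`, `¬ OnSiteAt 𝒰_cx X z`, `JammedOneAt X z` ⇒ `MonoModuleAt L X z` for every
  frame `L`: the jammed ball is off the module (`onSiteAt_of_module_insert`); if it caps a window triangle the window is mono-module (`monoModuleAt_of_capping`);
  otherwise every reader near the payer is a module ball with frame `D₊`/`D₋` (`…JammedFrames`), its target is a module ball, and an inspected ball is a module
  ball or the jammed ball at a dozen position (impossible, module) or at a mirrored-dozen position (exact by the first lemma);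
* **`jammedOneSmall_of_mono : JammedOneSmall s k₀`** for every `s`, `k₀` (the stub's hypothesis `¬ MonoModuleAt` is contradicted) — closes v5's
  `stub_jammedOneSmall` BY NAME (closer file `…CertificatesStubJammedOneSmall`); the census `JammedOneCensus` is thereby NOT needed for lane F.
WHAT THIS IS NOT: nothing on `stub_seamResidual`; F-C1 not moved.
-/

noncomputable section

namespace Summit.Ventures.Crystal3D.Theorems

namespace TailResidue

open Summit.Ventures.Crystal3D Finset
open scoped InnerProductSpace

/-- Unit vectors at inner product `½` are at distance `1`. -/
theorem norm_sub_eq_one_of_inner_half {u a : EuclideanSpace ℝ (Fin 3)} (hu : ‖u‖ = 1) (ha : ‖a‖ = 1) (h : ⟪u, a⟫_ℝ = 1 / 2) : ‖u - a‖ = 1 := by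
  have hsq : ‖u - a‖ ^ 2 = 1 := by rw [norm_sub_sq_real, hu, ha, h]; norm_num
  nlinarith [norm_nonneg (u - a)]

/-- **A mirrored-dozen position of a module ball, off the module and within `3` of the payer, is an exact (apex) position.** -/
theorem mem_exactPos_of_mirror {G : EuclideanSpace ℝ (Fin 3) ≃ₗᵢ[ℝ] EuclideanSpace ℝ (Fin 3)} {m w x : EuclideanSpace ℝ (Fin 3)} {s : ℤ × ℤ × ℤ}
    (hG : ∀ w ∈ fccSlots, G w ∈ coaxialModule 1 (Real.sqrt (2 / 3))) (hm : IsMenuNormal G m) (hw : w ∈ fccSlots) (hs : dsq12 (0, 0, 0) s ≤ 108)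
    (hx : x = modSite s + (G w - (2 * ⟪G w, m⟫_ℝ) • m)) (hxoff : x ∉ coaxialModule 1 (Real.sqrt (2 / 3))) (hx3 : dist (0 : EuclideanSpace ℝ (Fin 3)) x ≤ 3) :
    x ∈ exactPos := by
  -- the slot `w` is off the mirror plane (else `x` would be a module point)
  have hne : ⟪G w, m⟫_ℝ ≠ 0 := by
    intro h0
    apply hxoff
    rw [hx, h0, mul_zero, zero_smul, sub_zero]
    exact add_mem_module (modSite_mem_coaxialModule s) (hG w hw)
  -- two adjacent in-plane slots adjacent to `w`
  obtain ⟨u₁, hu₁, u₂, hu₂, h1, h2, h12, n1, n2⟩ : ∃ u₁ ∈ fccSlots, ∃ u₂ ∈ fccSlots, ⟪w, u₁⟫_ℝ = 1 / 2 ∧ ⟪w, u₂⟫_ℝ = 1 / 2 ∧ ⟪u₁, u₂⟫_ℝ = 1 / 2 ∧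
      ⟪G u₁, m⟫_ℝ = 0 ∧ ⟪G u₂, m⟫_ℝ = 0 := by
    rcases lt_or_gt_of_ne hne with hlt | hgt
    · exact exists_inplane_slot_triangle G hm hw hlt
    · have hm' : IsMenuNormal G (-m) := by
        refine ⟨by rw [norm_neg, hm.1], fun w hw => ?_⟩
        rcases hm.2 w hw with h0 | h0 | h0
        · exact Or.inl (by rw [inner_neg_right, h0, neg_zero])
        · exact Or.inr (Or.inr (by rw [inner_neg_right, h0]))
        · exact Or.inr (Or.inl (by rw [inner_neg_right, h0, neg_neg]))
      obtain ⟨u₁, hu₁, u₂, hu₂, h1, h2, h12, n1, n2⟩ := exists_inplane_slot_triangle G hm' hw (by rw [inner_neg_right]; linarith)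
      exact ⟨u₁, hu₁, u₂, hu₂, h1, h2, h12, by rw [inner_neg_right] at n1; linarith, by rw [inner_neg_right] at n2; linarith⟩
  -- the three module points `q, q + G u₁, q + G u₂` in site coordinates
  obtain ⟨d₁, hd₁⟩ := mem_coaxialModule_iff.1 (hG u₁ hu₁)
  obtain ⟨d₂, hd₂⟩ := mem_coaxialModule_iff.1 (hG u₂ hu₂)
  have ht₂ : modSite s + G u₁ = modSite (addSite s d₁) := by rw [modSite_addSite, hd₁]
  have ht₃ : modSite s + G u₂ = modSite (addSite s d₂) := by rw [modSite_addSite, hd₂]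
  have d12 : dist (modSite s) (modSite (addSite s d₁)) = 1 := by rw [← ht₂]; exact dist_slotSite_eq_one G _ hu₁
  have d13 : dist (modSite s) (modSite (addSite s d₂)) = 1 := by rw [← ht₃]; exact dist_slotSite_eq_one G _ hu₂
  have d23 : dist (modSite (addSite s d₁)) (modSite (addSite s d₂)) = 1 := by rw [← ht₂, ← ht₃]; exact dist_frame_slots_eq_one G _ hu₁ hu₂ h12
  -- the mirrored vector caps them
  set u : EuclideanSpace ℝ (Fin 3) := G w - (2 * ⟪G w, m⟫_ℝ) • m with hu
  have hun : ‖u‖ = 1 := norm_reflectStep_slot G hm.1 hw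
  have hiu : ∀ {a : EuclideanSpace ℝ (Fin 3)}, a ∈ fccSlots → ⟪w, a⟫_ℝ = 1 / 2 → ⟪G a, m⟫_ℝ = 0 → ⟪u, G a⟫_ℝ = 1 / 2 := by
    intro a _ hwa hna
    have hma : ⟪m, G a⟫_ℝ = 0 := by rw [real_inner_comm]; exact hna
    rw [hu, inner_sub_left, inner_smul_left, LinearIsometryEquiv.inner_map_map, hwa, hma]
    simp
  have e1 : dist x (modSite s) = 1 := by rw [hx, dist_comm, dist_add_right_eq]; exact hun
  have e2 : dist x (modSite (addSite s d₁)) = 1 := by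
    rw [← ht₂, hx, dist_eq_norm, add_sub_add_left_eq_sub]
    exact norm_sub_eq_one_of_inner_half hun (by rw [LinearIsometryEquiv.norm_map, norm_eq_one_of_mem_fccSlots hu₁]) (hiu hu₁ h1 n1)
  have e3 : dist x (modSite (addSite s d₂)) = 1 := by
    rw [← ht₃, hx, dist_eq_norm, add_sub_add_left_eq_sub]
    exact norm_sub_eq_one_of_inner_half hun (by rw [LinearIsometryEquiv.norm_map, norm_eq_one_of_mem_fccSlots hu₂]) (hiu hu₂ h2 n2)
  exact mem_exactPos_of_capping hxoff hx3 hs d12 d13 d23 e1 e2 e3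

open scoped Classical in
/-- **U-A1 WINDOWS ARE MONO-MODULE.**  In a `1`-separated configuration, at a payer `z` of degree `≤ 11` whose window is NOT on-site for 𝒰_cx but becomes on-site
after removing one ball of `≤ 3` contacts, the window is mono-module for every frame `L`. -/
theorem monoModuleAt_of_jammedOneAt {L : EuclideanSpace ℝ (Fin 3) ≃ₗᵢ[ℝ] EuclideanSpace ℝ (Fin 3)} {X : Finset (EuclideanSpace ℝ (Fin 3))}
    {z : EuclideanSpace ℝ (Fin 3)} (hX : ∀ p ∈ X, ∀ q ∈ X, p ≠ q → 1 ≤ dist p q) (hdeg : (X.filter fun q => dist z q = 1).card ≤ 11)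
    (hoff : ¬ OnSiteAt coaxialModuleUniverse X z) (hJ : JammedOneAt X z) : MonoModuleAt L X z := by
  obtain ⟨x, hx, -, -, P, hP, S, hwin⟩ := hJ
  set x' : EuclideanSpace ℝ (Fin 3) := S.symm x + -S.symm z with hx'
  have hzx : dist z x ≤ 3 := dist_le_three_of_jammedOneAt hoff ⟨P, hP, S, hwin⟩
  have hx'off : x' ∉ coaxialModule 1 (Real.sqrt (2 / 3)) := fun h => hoff (onSiteAt_of_module_insert hX hdeg hP hwin hx hzx h)
  -- capping case: mono-module by `monoModuleAt_of_capping`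
  by_cases hcx : ∃ t₁ ∈ P, ∃ t₂ ∈ P, ∃ t₃ ∈ P, dist t₁ t₂ = 1 ∧ dist t₁ t₃ = 1 ∧ dist t₂ t₃ = 1 ∧
      dist x' t₁ = 1 ∧ dist x' t₂ = 1 ∧ dist x' t₃ = 1
  · obtain ⟨t₁, ht₁, t₂, ht₂, t₃, ht₃, d12, d13, d23, e1, e2, e3⟩ := hcx
    exact monoModuleAt_of_capping hP hwin hx hzx hx'off ht₁ ht₂ ht₃ d12 d13 d23 e1 e2 e3
  have hcapP : ∀ t₁ ∈ P, ∀ t₂ ∈ P, ∀ t₃ ∈ P, dist t₁ t₂ = 1 → dist t₁ t₃ = 1 → dist t₂ t₃ = 1 →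
      dist x' t₁ = 1 → dist x' t₂ = 1 → dist x' t₃ = 1 → False :=
    fun t₁ ht₁ t₂ ht₂ t₃ ht₃ d12 d13 d23 e1 e2 e3 => hcx ⟨t₁, ht₁, t₂, ht₂, t₃, ht₃, d12, d13, d23, e1, e2, e3⟩
  -- the truncated window `Y = insert x' P`
  have hagree := onSite_window_agree hwin
  have hPmod := mem_coaxialModule_of_mem_universe hP
  set Y : Finset (EuclideanSpace ℝ (Fin 3)) := insert x' P with hY
  have hwin' : ∀ y, dist (0 : EuclideanSpace ℝ (Fin 3)) y ≤ 3 → (y ∈ X.image (fun y => S.symm y + -S.symm z) ↔ y ∈ Y) := by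
    intro y hy
    rw [hY, mem_insert]
    constructor
    · intro hyX
      obtain ⟨y₀, hy₀, rfl⟩ := mem_image.1 hyX
      by_cases h0 : y₀ = x
      · left; rw [h0]
      · right; exact (hagree _ hy).1 (mem_image_of_mem _ (mem_erase.2 ⟨h0, hy₀⟩))
    · rintro (rfl | hyP)
      · exact mem_image_of_mem _ hx
      · exact image_subset_image (erase_subset _ _) ((hagree _ hy).2 hyP)
  have hmod : ∀ y ∈ Y, dist (0 : EuclideanSpace ℝ (Fin 3)) y ≤ 3 → y ≠ x' → y ∈ coaxialModule 1 (Real.sqrt (2 / 3)) := by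
    intro y hy _ hyx
    rcases mem_insert.1 hy with h | h
    · exact absurd h hyx
    · exact hPmod y h
  have hcapY : ∀ t₁ ∈ Y, ∀ t₂ ∈ Y, ∀ t₃ ∈ Y, dist t₁ t₂ = 1 → dist t₁ t₃ = 1 → dist t₂ t₃ = 1 →
      dist x' t₁ = 1 → dist x' t₂ = 1 → dist x' t₃ = 1 → False := by
    intro t₁ ht₁ t₂ ht₂ t₃ ht₃ d12 d13 d23 e1 e2 e3
    have mem : ∀ {t}, t ∈ Y → dist x' t = 1 → t ∈ P := by
      intro t ht e
      rcases mem_insert.1 ht with rfl | ht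
      · rw [dist_self] at e; exact absurd e zero_ne_one
      · exact ht
    exact hcapP t₁ (mem ht₁ e1) t₂ (mem ht₂ e2) t₃ (mem ht₃ e3) d12 d13 d23 e1 e2 e3
  -- the mono-module clause for the placement `S`
  refine ⟨S, fun b q G d hb hq hbX hadm _ hmove => ?_⟩
  obtain ⟨w₀, hw₀, hdw⟩ : ∃ w₀ ∈ fccSlots, d = G w₀ := by
    rcases hadm with h | h
    · exact (exists_slots_of_adm (basalSystem_roots _) h).1
    · exact (exists_slots_of_adm (basalSystem_roots _) h).1
  have hd1 : ‖d‖ = 1 := by rw [hdw, LinearIsometryEquiv.norm_map, norm_eq_one_of_mem_fccSlots hw₀]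
  have hbq : dist b q = 1 := dist_eq_one_of_isEndMove hd1 hmove
  have hq2 : dist (0 : EuclideanSpace ℝ (Fin 3)) q ≤ 2 := by linarith [dist_triangle (0 : EuclideanSpace ℝ (Fin 3)) b q]
  have hmoveY : IsEndMove Y WordVersion.v2 G d q b :=
    (isEndMove_congr_of_agree hwin' WordVersion.v2 G hd1 (by linarith) (by linarith)).1 hmove
  have hqY : q ∈ Y := (hwin' q (by linarith)).1 hq
  have hbY : b ∈ Y := (hwin' b (by linarith)).1 hbX
  -- the reader is not the jammed ball (its reading triangle would be capped by it)
  have hqx : q ≠ x' := by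
    intro hqx
    obtain ⟨u₁, hu₁, u₂, hu₂, u₃, hu₃, h12, h13, h23, o1, o2, o3⟩ := exists_contact_triangle_of_isEndMove hmoveY
    rw [hqx] at o1 o2 o3
    refine hcapY _ o1 _ o2 _ o3 (dist_frame_slots_eq_one G _ hu₁ hu₂ h12) (dist_frame_slots_eq_one G _ hu₁ hu₃ h13)
      (dist_frame_slots_eq_one G _ hu₂ hu₃ h23) (dist_slotSite_eq_one G _ hu₁) (dist_slotSite_eq_one G _ hu₂) (dist_slotSite_eq_one G _ hu₃)
  have hqP : q ∈ P := (mem_insert.1 hqY).resolve_left hqx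
  have hG := slots_mem_module_of_reader hmod hcapY hqY hqx hq2 hmoveY
  have hqM : q ∈ coaxialModule 1 (Real.sqrt (2 / 3)) := hPmod q hqP
  -- the target is a module ball
  have hbM : b ∈ coaxialModule 1 (Real.sqrt (2 / 3)) := by
    rcases hmoveY with ⟨-, hbe, -⟩ | ⟨m, htw, -, hbe, -⟩
    · rw [hbe, hdw]; exact add_mem_module hqM (hG w₀ hw₀)
    · rw [hbe, hdw]; exact sub_mem_module hqM (mirror_mem_module_of_twinReading hmod hcapY hqY hqx hq2 htw hG w₀ hw₀)
  have hbx : b ≠ x' := ne_of_mem_module hx'off hbM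
  have hbP : b ∈ P := (mem_insert.1 hbY).resolve_left hbx
  obtain ⟨sq, hsq, hq_eq⟩ := exists_site_of_mem_universe hP hqP
  obtain ⟨sb, hsb, hb_eq⟩ := exists_site_of_mem_universe hP hbP
  refine ⟨mem_exactPos_of_mem_universe hP hqP, mem_exactPos_of_mem_universe hP hbP, fun y hy hins => ?_⟩
  -- inspected balls: within `3`, hence in `Y`; pattern balls are exact, and the jammed ball at an inspected position is exact
  obtain ⟨w, hw, h⟩ := hins
  have hy3 : dist (0 : EuclideanSpace ℝ (Fin 3)) y ≤ 3 := by
    have hb2 : dist (0 : EuclideanSpace ℝ (Fin 3)) b ≤ 2 := by linarith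
    rcases h with rfl | rfl | ⟨m, hm, rfl | rfl⟩
    · linarith [dist_triangle (0 : EuclideanSpace ℝ (Fin 3)) q (q + G w), dist_slotSite_eq_one G q hw]
    · linarith [dist_triangle (0 : EuclideanSpace ℝ (Fin 3)) b (b + G w), dist_slotSite_eq_one G b hw]
    · have : dist q (q + (G w - (2 * ⟪G w, m⟫_ℝ) • m)) = 1 := by rw [dist_add_right_eq]; exact norm_reflectStep_slot G hm.1 hw
      linarith [dist_triangle (0 : EuclideanSpace ℝ (Fin 3)) q (q + (G w - (2 * ⟪G w, m⟫_ℝ) • m))]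
    · have : dist b (b + (G w - (2 * ⟪G w, m⟫_ℝ) • m)) = 1 := by rw [dist_add_right_eq]; exact norm_reflectStep_slot G hm.1 hw
      linarith [dist_triangle (0 : EuclideanSpace ℝ (Fin 3)) b (b + (G w - (2 * ⟪G w, m⟫_ℝ) • m))]
  have hyY : y ∈ Y := (hwin' y hy3).1 hy
  rcases mem_insert.1 hyY with hyx | hyP
  · -- the jammed ball itself: a dozen position is a module point (impossible), a mirrored one is an apex position
    rw [hyx]
    rcases h with hxe | hxe | ⟨m, hm, hxe | hxe⟩
    · exact absurd (by rw [← hyx, hxe]; exact add_mem_module hqM (hG w hw)) hx'off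
    · exact absurd (by rw [← hyx, hxe]; exact add_mem_module hbM (hG w hw)) hx'off
    · exact mem_exactPos_of_mirror hG hm hw hsq (by rw [← hq_eq, ← hyx, hxe]) hx'off (by rw [← hyx]; exact hy3)
    · exact mem_exactPos_of_mirror hG hm hw hsb (by rw [← hb_eq, ← hyx, hxe]) hx'off (by rw [← hyx]; exact hy3)
  · exact mem_exactPos_of_mem_universe hP hyP

/-- **THE U-A1 STUB OUTRIGHT**: `JammedOneSmall s k₀` for every line `s` and cut `k₀` — its hypothesis `¬ MonoModuleAt` contradicts `monoModuleAt_of_jammedOneAt`. -/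
theorem jammedOneSmall_of_mono (s : ℝ) (k₀ : ℕ) : JammedOneSmall s k₀ :=
  fun _ _ hX _ _ hdeg hoff hM _ hJ => absurd (monoModuleAt_of_jammedOneAt hX hdeg hoff hJ) hM

/-- The instance of record: `JammedOneSmall (2√6) 3`. -/
theorem jammedOneSmall_twoSqrtSix : JammedOneSmall (2 * Real.sqrt 6) 3 :=
  jammedOneSmall_of_mono _ _

end TailResidue

end Summit.Ventures.Crystal3D.Theorems

end
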